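import Summits.CriticalPhenomena.PercolationContinuityZ3.Theorems.SahiMasterFamilyPhiCapClosedForm
import Summits.CriticalPhenomena.PercolationContinuityZ3.Theorems.SahiMasterFamilyPhiSegment

/-!
# Bernstein positivity of bounded degree (`BPos`), the block expansion of `Φ` along the last index and the CAP IDENTITY
# `Σ_{B ∋ last} (|B|−1)!·κ_B(β) = Σ_σ ∏_{c ∈ cyc σ} (1 − β_c)` for EVERY real set function — the polynomial book-keeping behind
# conjecture (B) on nested pairs (`…UCBernsteinNested`)

Unit `prim-masterthm-p4` (gen 22; crux anchor stmt-CriticalPhenomena-4575, helper work; memo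
`run/shared/lean/prim/prim-masterthm/prim-masterthm-p4/P4-GEN22-REPORT.md` §2).  Companion of `…UCBernstein` (typed conjecture (B): the
degree-`k` Bernstein coefficients = layer sums of the mixture polynomial of union-closed families are `≥ 0`), `…PrincipalCapStep` (the
abstract step as an INEQUALITY), `…PhiCapClosedForm` (`Φ(cap β) = Σ_σ ∏_c (1 − β_c)` for `β univ = 1`) and `…PhiOrbit` (relabelling).

CONTENTS (no new mathematics is claimed for the first part; it is the algebra of "nonnegative combinations of Bernstein monomials"):
* `BPos d f`: `f : ℝ → ℝ` agrees identically with `Σ_i a_i w^{p_i}(1−w)^{q_i}`, `a_i ≥ 0`, `p_i + q_i ≤ d` — equivalently (multiply each monomial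
  by `(w + (1−w))^{d−p_i−q_i}`) the degree-`d` Bernstein coefficients of `f` are nonnegative; closed under `+`, `·` (degrees add), nonnegative
  scalars, finite sums and products, reflection `w ↦ 1−w`, degree raising; implies `f ≥ 0` on `[0,1]` (`BPos.nonneg`).
* `phiSet_eq_sum_blocks_last`: Lieb–Sahi's block expansion [LiebSahi2021, Prop. 3.4] read at the level of `phiSet` for an arbitrary real set
  function: `Φ_{k+1}(β) = Σ_{B ∋ last} (|B|−1)!·β_B·κ_B(β)`, `κ_B(β) = coRest (realW β) realF B` (`= 1` for `B = univ`, `= −Φ(β|_{Bᶜ})` along a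
  block-dependent embedding otherwise, `exists_emb_coRest`, uniformly in `β`).
* **`sum_blocks_coRest_eq_W` (cap identity, every `β`)**: `Σ_{B ∋ last} (|B|−1)!·κ_B(β) = W(β) := Σ_{σ ∈ S_k} ∏_{c ∈ cyc σ} (1 − β_c)` — the block
  expansion of `Φ(cap β)` against `PhiCapClosedForm.phiSet_cap_eq_sum_perm`, the `κ_B` seeing `β` only off the last index; hence the abstract
  step as an IDENTITY `phiSet_eq_W_add_sum`: `Φ(β) = W(β) + Σ_{B ∋ last} (|B|−1)!·(1 − β_B)·(−κ_B(β))` (gen 13's inequality is the case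
  `β ≤ 1`, `−κ_B ≥ 0`).
* the two-family mixture `mix 𝒰 𝒱 w = w·1_𝒰 + (1−w)·1_𝒱`, pull-backs `comap e 𝒰` along embeddings (restrictions of mixtures are mixtures of
  pull-backs, `mix_map`; relabelling invariance `phiSet_mix_comap_perm`), and for NESTED `𝒰 ⊆ 𝒱`: every defect factor `1 − β_S ∈ {0, w, 1}` is
  `BPos 1` and `W(mix 𝒰 𝒱 w)` is `BPos k` (`bpos_W`, a permutation of `Fin k` having at most `k` cycles).
HONEST FRAMING: toolkit; conjecture (B), `UCHullNonneg k` (k ≥ 8), Sahi's `C_k` and the master theorem remain OPEN.  Axioms standard. [this work]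
-/

noncomputable section

open scoped Classical

namespace Summit.CriticalPhenomena.PercolationContinuityZ3.Theorems

namespace BernsteinPos

open Finset Function Equiv
open Literature.Combinatorics.Sahi2008
open Literature.Combinatorics.Sahi2008.CycleForm
open PrincipalCapBeta (phiSet realF realW)

/-! ### Bernstein positivity of bounded degree -/

/-- `BPos d f`: the real function `f` agrees on all of `ℝ` with a nonnegative combination of the monomials `w^p (1−w)^q`,
`p + q ≤ d` (equivalently, after multiplying by powers of `w + (1−w) = 1`, its degree-`d` Bernstein coefficients are `≥ 0`). [this work] -/
def BPos (d : ℕ) (f : ℝ → ℝ) : Prop :=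
  ∃ (ι : Type) (_ : Fintype ι) (a : ι → ℝ) (p q : ι → ℕ),
    (∀ i, 0 ≤ a i) ∧ (∀ i, p i + q i ≤ d) ∧ ∀ w, f w = ∑ i, a i * (w ^ p i * (1 - w) ^ q i)

/-- Degree monotonicity. [this work] -/
theorem BPos.mono {d d' : ℕ} {f : ℝ → ℝ} (h : BPos d f) (hd : d ≤ d') : BPos d' f := by
  obtain ⟨ι, hι, a, p, q, ha, hpq, hf⟩ := h
  exact ⟨ι, hι, a, p, q, ha, fun i => (hpq i).trans hd, hf⟩

/-- Transport along pointwise equality. [this work] -/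
theorem BPos.congr {d : ℕ} {f g : ℝ → ℝ} (h : BPos d f) (hfg : ∀ w, f w = g w) : BPos d g := by
  obtain ⟨ι, hι, a, p, q, ha, hpq, hf⟩ := h
  exact ⟨ι, hι, a, p, q, ha, hpq, fun w => (hfg w).symm.trans (hf w)⟩

/-- A single monomial with a nonnegative coefficient. [this work] -/
theorem bpos_monomial {d : ℕ} {c : ℝ} (hc : 0 ≤ c) (p q : ℕ) (h : p + q ≤ d) :
    BPos d (fun w => c * (w ^ p * (1 - w) ^ q)) :=
  ⟨Unit, inferInstance, fun _ => c, fun _ => p, fun _ => q, fun _ => hc, fun _ => h,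
    fun w => (Fintype.sum_unique (fun _ : Unit => c * (w ^ p * (1 - w) ^ q))).symm⟩

/-- Nonnegative constants. [this work] -/
theorem bpos_const {d : ℕ} {c : ℝ} (hc : 0 ≤ c) : BPos d (fun _ => c) :=
  (bpos_monomial hc 0 0 (Nat.zero_le _)).congr fun w => by ring

/-- The zero function. [this work] -/
theorem bpos_zero {d : ℕ} : BPos d (fun _ => 0) :=
  ⟨Fin 0, inferInstance, fun _ => 0, fun _ => 0, fun _ => 0, fun _ => le_rfl, fun _ => Nat.zero_le _, fun w => by simp⟩

/-- `w` is Bernstein-positive of degree `1`. [this work] -/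
theorem bpos_id : BPos 1 (fun w => w) :=
  (bpos_monomial zero_le_one 1 0 (by norm_num)).congr fun w => by ring

/-- `1 − w` is Bernstein-positive of degree `1`. [this work] -/
theorem bpos_one_sub : BPos 1 (fun w => 1 - w) :=
  (bpos_monomial zero_le_one 0 1 (by norm_num)).congr fun w => by ring

/-- Sums. [this work] -/
theorem BPos.add {d : ℕ} {f g : ℝ → ℝ} (hf : BPos d f) (hg : BPos d g) : BPos d (fun w => f w + g w) := by
  obtain ⟨ι, hι, a, p, q, ha, hpq, hf⟩ := hf
  obtain ⟨ι', hι', a', p', q', ha', hpq', hg⟩ := hg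
  refine ⟨ι ⊕ ι', inferInstance, Sum.elim a a', Sum.elim p p', Sum.elim q q', ?_, ?_, fun w => ?_⟩
  · rintro (i | i)
    · exact ha i
    · exact ha' i
  · rintro (i | i)
    · exact hpq i
    · exact hpq' i
  · show f w + g w = _
    rw [Fintype.sum_sum_type, hf w, hg w]
    simp only [Sum.elim_inl, Sum.elim_inr]

/-- Products (degrees add). [this work] -/
theorem BPos.mul {d d' : ℕ} {f g : ℝ → ℝ} (hf : BPos d f) (hg : BPos d' g) : BPos (d + d') (fun w => f w * g w) := by
  obtain ⟨ι, hι, a, p, q, ha, hpq, hf⟩ := hf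
  obtain ⟨ι', hι', a', p', q', ha', hpq', hg⟩ := hg
  refine ⟨ι × ι', inferInstance, fun i => a i.1 * a' i.2, fun i => p i.1 + p' i.2, fun i => q i.1 + q' i.2,
    fun i => mul_nonneg (ha _) (ha' _), fun i => ?_, fun w => ?_⟩
  · have h1 := hpq i.1
    have h2 := hpq' i.2
    show p i.1 + p' i.2 + (q i.1 + q' i.2) ≤ d + d'
    omega
  · show f w * g w = _
    rw [hf w, hg w, Finset.sum_mul_sum, Fintype.sum_prod_type]
    refine Finset.sum_congr rfl fun i _ => Finset.sum_congr rfl fun j _ => ?_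
    rw [pow_add, pow_add]
    ring

/-- Nonnegative scalar multiples. [this work] -/
theorem BPos.smul {d : ℕ} {f : ℝ → ℝ} (hf : BPos d f) {c : ℝ} (hc : 0 ≤ c) : BPos d (fun w => c * f w) :=
  ((bpos_const (d := 0) hc).mul hf).mono (Nat.zero_add d).le

/-- Finite sums. [this work] -/
theorem BPos.sum {d : ℕ} {κ : Type*} (s : Finset κ) (f : κ → ℝ → ℝ) (h : ∀ i ∈ s, BPos d (f i)) :
    BPos d (fun w => ∑ i ∈ s, f i w) := by
  induction s using Finset.induction_on with
  | empty => exact bpos_zero.congr fun w => by simp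
  | insert a s ha ih =>
    exact ((h a (mem_insert_self a s)).add (ih fun i hi => h i (mem_insert_of_mem hi))).congr
      fun w => (sum_insert ha (f := fun i => f i w)).symm

/-- Finite products of degree-`1` factors. [this work] -/
theorem BPos.prod {κ : Type*} (s : Finset κ) (f : κ → ℝ → ℝ) (h : ∀ i ∈ s, BPos 1 (f i)) :
    BPos s.card (fun w => ∏ i ∈ s, f i w) := by
  induction s using Finset.induction_on with
  | empty => exact (bpos_const zero_le_one).congr fun w => by simp
  | insert a s ha ih =>
    have hm := (h a (mem_insert_self a s)).mul (ih fun i hi => h i (mem_insert_of_mem hi))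
    rw [card_insert_of_notMem ha]
    exact (hm.mono (by omega)).congr fun w => (prod_insert ha (f := fun i => f i w)).symm

/-- Reflection `w ↦ 1 − w`. [this work] -/
theorem BPos.reflect {d : ℕ} {f : ℝ → ℝ} (hf : BPos d f) : BPos d (fun w => f (1 - w)) := by
  obtain ⟨ι, hι, a, p, q, ha, hpq, hf⟩ := hf
  refine ⟨ι, hι, a, q, p, ha, fun i => by have := hpq i; omega, fun w => ?_⟩
  show f (1 - w) = _
  rw [hf (1 - w)]
  refine Finset.sum_congr rfl fun i _ => ?_
  rw [sub_sub_cancel]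
  ring

/-- A Bernstein-positive function is nonnegative on `[0,1]`. [this work] -/
theorem BPos.nonneg {d : ℕ} {f : ℝ → ℝ} (h : BPos d f) {w : ℝ} (hw0 : 0 ≤ w) (hw1 : w ≤ 1) : 0 ≤ f w := by
  obtain ⟨ι, hι, a, p, q, ha, hpq, hf⟩ := h
  rw [hf w]
  exact Finset.sum_nonneg fun i _ =>
    mul_nonneg (ha i) (mul_nonneg (pow_nonneg hw0 _) (pow_nonneg (by linarith) _))

/-! ### The block expansion along the last index and the cap identity, for every real set function -/

section Identities

variable {k : ℕ}

/-- **Block expansion along the last index** at the level of `phiSet` [LiebSahi2021, Prop. 3.4 in the canonical signed model]: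
`Φ_{k+1}(β) = Σ_{B ∋ last} (|B|−1)!·β_B·κ_B`, `κ_B = coRest (realW β) realF B`. [this work] -/
theorem phiSet_eq_sum_blocks_last (β : Finset (Fin (k + 1)) → ℝ) :
    phiSet (k + 1) β = ∑ B ∈ univ.filter (fun B : Finset (Fin (k + 1)) => Fin.last k ∈ B),
      ((B.card - 1).factorial : ℝ) * (β B * coRest (realW β) realF B) := by
  have hk : 1 ≤ k + 1 := Nat.succ_le_succ (Nat.zero_le k)
  rw [PrincipalCapBeta.phiSet_eq_sahiE_real, sahiE_eq_sum_blocks (realW β) hk realF (Fin.last k)]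
  refine sum_congr rfl fun B _ => ?_
  have mF : ex (realW β) (fun x => ∏ j ∈ B, realF j x) = β B := by
    have e1 : (fun x => ∏ j ∈ B, realF j x) = ∏ j ∈ B, (realF j : Finset (Fin (k + 1)) → ℝ) :=
      funext fun x => (Finset.prod_apply x B _).symm
    rw [e1, PrincipalCapBeta.ex_realW_prod]
  rw [mF]

/-- The complementary factor of a proper block is minus the honest sub-functional of the restriction to the complement, along an
embedding that depends on the block only (`PrincipalCapStep.coRest_realF_eq`, uniformly in `β`). [this work] -/
theorem exists_emb_coRest {B : Finset (Fin (k + 1))} (hBu : B ≠ univ) :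
    ∃ (n : ℕ) (e : Fin (n + 1) ↪ Fin (k + 1)), (∀ j, e j ∉ B) ∧
      ∀ β : Finset (Fin (k + 1)) → ℝ, coRest (realW β) realF B = -phiSet (n + 1) (fun S => β (S.map e)) := by
  obtain ⟨y, hy⟩ : ∃ y, y ∉ B := not_forall.1 (mt eq_univ_iff_forall.2 hBu)
  have hN : 0 < Fintype.card {x // x ∉ B} := Fintype.card_pos_iff.2 ⟨⟨y, hy⟩⟩
  obtain ⟨n, hn⟩ : ∃ n, Fintype.card {x // x ∉ B} = n + 1 := ⟨Fintype.card {x // x ∉ B} - 1, by omega⟩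
  let e0 : Fin (n + 1) ≃ {x // x ∉ B} := ((Fintype.equivFin {x // x ∉ B}).trans (finCongr hn)).symm
  let e : Fin (n + 1) ↪ Fin (k + 1) := e0.toEmbedding.trans (Embedding.subtype _)
  refine ⟨n, e, fun j => (e0 j).2, fun β => ?_⟩
  rw [coRest_of_ne_univ _ _ hBu, ← cycleSum_comp_equiv (realW β) e0 (fun j : {x // x ∉ B} => realF (j : Fin (k + 1))),
    ← sahiE_eq_cycleSum (realW β) (Nat.succ_le_succ (Nat.zero_le n)), PrincipalCapBeta.sahiE_eq_phiSet]
  congr 2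
  funext S
  have e1 : (∏ x ∈ S, realF ((e0 x : {x // x ∉ B}) : Fin (k + 1))) = ∏ x ∈ S.map e, realF x := by
    rw [prod_map]; rfl
  rw [e1, PrincipalCapBeta.ex_realW_prod]

/-- The complementary factors of blocks through the last index only see `β` off the last index. [this work] -/
theorem coRest_congr_off_last {β β' : Finset (Fin (k + 1)) → ℝ} (h : ∀ S, Fin.last k ∉ S → β' S = β S)
    {B : Finset (Fin (k + 1))} (hB : Fin.last k ∈ B) : coRest (realW β') realF B = coRest (realW β) realF B := by
  by_cases hBu : B = univ
  · rw [hBu, coRest_univ, coRest_univ]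
  · obtain ⟨n, e, he, hc⟩ := exists_emb_coRest hBu
    rw [hc β', hc β]
    congr 2
    funext S
    refine h _ fun hl => ?_
    obtain ⟨j, _, hj⟩ := mem_map.1 hl
    exact he j (by rw [hj]; exact hB)

/-- **Cap identity, every real set function**: `Σ_{B ∋ last} (|B|−1)!·κ_B(β) = W(β) := Σ_{σ ∈ S_k} ∏_{c ∈ cyc σ} (1 − β_c)` — the block
expansion of `Φ(cap β)` (whose last-star values are `1`) against `PhiCapClosedForm.phiSet_cap_eq_sum_perm`. [this work] -/
theorem sum_blocks_coRest_eq_W (β : Finset (Fin (k + 1)) → ℝ) :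
    ∑ B ∈ univ.filter (fun B : Finset (Fin (k + 1)) => Fin.last k ∈ B),
      ((B.card - 1).factorial : ℝ) * coRest (realW β) realF B =
    ∑ σ : Perm (Fin k), ∏ B ∈ orbits σ, (1 - β (B.map Fin.castSuccEmb)) := by
  let β' : Finset (Fin (k + 1)) → ℝ := fun B => if Fin.last k ∈ B then 1 else β B
  have hβ' : ∀ S, Fin.last k ∉ S → β' S = β S := fun S hS => if_neg hS
  have hcap := PhiCapClosedForm.phiSet_cap_eq_sum_perm β' (if_pos (mem_univ _))
  have e1 : (fun B : Finset (Fin (k + 1)) => if Fin.last k ∈ B then (1 : ℝ) else β' B) = β' := by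
    funext B
    by_cases h : Fin.last k ∈ B
    · rw [if_pos h]; exact (if_pos h).symm
    · rw [if_neg h]
  rw [e1] at hcap
  calc ∑ B ∈ univ.filter (fun B : Finset (Fin (k + 1)) => Fin.last k ∈ B),
        ((B.card - 1).factorial : ℝ) * coRest (realW β) realF B
      = ∑ B ∈ univ.filter (fun B : Finset (Fin (k + 1)) => Fin.last k ∈ B),
        ((B.card - 1).factorial : ℝ) * (β' B * coRest (realW β') realF B) := by
          refine sum_congr rfl fun B hB => ?_
          have hl : Fin.last k ∈ B := (mem_filter.1 hB).2
          rw [coRest_congr_off_last hβ' hl, show β' B = 1 from if_pos hl, one_mul]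
    _ = phiSet (k + 1) β' := (phiSet_eq_sum_blocks_last β').symm
    _ = ∑ σ : Perm (Fin k), ∏ B ∈ orbits σ, (1 - β' (B.map Fin.castSuccEmb)) := hcap
    _ = ∑ σ : Perm (Fin k), ∏ B ∈ orbits σ, (1 - β (B.map Fin.castSuccEmb)) :=
          sum_congr rfl fun σ _ => prod_congr rfl fun B _ => by
            rw [hβ' _ fun h => by obtain ⟨x, _, hx⟩ := mem_map.1 h; exact Fin.castSucc_ne_last x hx]

/-- **The all-`β` form of the abstract step as an IDENTITY**:
`Φ_{k+1}(β) = W(β) + Σ_{B ∋ last} (|B|−1)!·(1 − β_B)·(−κ_B)` (`κ_univ = 1`, `κ_B = −Φ(β|_{Bᶜ})` otherwise). [this work] -/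
theorem phiSet_eq_W_add_sum (β : Finset (Fin (k + 1)) → ℝ) :
    phiSet (k + 1) β = (∑ σ : Perm (Fin k), ∏ B ∈ orbits σ, (1 - β (B.map Fin.castSuccEmb))) +
      ∑ B ∈ univ.filter (fun B : Finset (Fin (k + 1)) => Fin.last k ∈ B),
        ((B.card - 1).factorial : ℝ) * ((1 - β B) * (-coRest (realW β) realF B)) := by
  rw [phiSet_eq_sum_blocks_last, ← sum_blocks_coRest_eq_W β, ← sum_add_distrib]
  exact sum_congr rfl fun B _ => by ring

end Identities

/-! ### Mixtures of two families and their restrictions -/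

variable {n : ℕ}

/-- The mixture point `w·1_𝒰 + (1−w)·1_𝒱` of two families. [this work] -/
def mix (𝒰 𝒱 : Finset (Finset (Fin n))) (w : ℝ) : Finset (Fin n) → ℝ :=
  fun S => w * (if S ∈ 𝒰 then 1 else 0) + (1 - w) * (if S ∈ 𝒱 then 1 else 0)

/-- The pull-back of a family along an embedding. [this work] -/
def comap {m : ℕ} (e : Fin m ↪ Fin n) (𝒰 : Finset (Finset (Fin n))) : Finset (Finset (Fin m)) :=
  univ.filter fun S => S.map e ∈ 𝒰

/-- Membership in the pull-back. [this work] -/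
theorem mem_comap {m : ℕ} (e : Fin m ↪ Fin n) (𝒰 : Finset (Finset (Fin n))) (S : Finset (Fin m)) :
    S ∈ comap e 𝒰 ↔ S.map e ∈ 𝒰 := by
  unfold comap; rw [mem_filter]; exact ⟨fun h => h.2, fun h => ⟨mem_univ _, h⟩⟩

/-- Pull-backs of union-closed families are union-closed. [this work] -/
theorem comap_unionClosed {m : ℕ} (e : Fin m ↪ Fin n) (𝒰 : Finset (Finset (Fin n)))
    (hU : ∀ A ∈ 𝒰, ∀ B ∈ 𝒰, A ∪ B ∈ 𝒰) : ∀ A ∈ comap e 𝒰, ∀ B ∈ comap e 𝒰, A ∪ B ∈ comap e 𝒰 := by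
  intro A hA B hB
  rw [mem_comap] at hA hB ⊢
  rw [Finset.map_union]
  exact hU _ hA _ hB

/-- Pull-back is monotone. [this work] -/
theorem comap_mono {m : ℕ} (e : Fin m ↪ Fin n) {𝒰 𝒱 : Finset (Finset (Fin n))} (h : 𝒰 ⊆ 𝒱) : comap e 𝒰 ⊆ comap e 𝒱 :=
  fun S hS => (mem_comap e 𝒱 S).2 (h ((mem_comap e 𝒰 S).1 hS))

/-- The restriction of a mixture along an embedding is the mixture of the pulled-back families. [this work] -/
theorem mix_map {m : ℕ} (e : Fin m ↪ Fin n) (𝒰 𝒱 : Finset (Finset (Fin n))) (w : ℝ) :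
    (fun S : Finset (Fin m) => mix 𝒰 𝒱 w (S.map e)) = mix (comap e 𝒰) (comap e 𝒱) w := by
  funext S
  unfold mix
  by_cases hU : S.map e ∈ 𝒰 <;> by_cases hV : S.map e ∈ 𝒱 <;>
    simp only [hU, hV, (mem_comap e 𝒰 S), (mem_comap e 𝒱 S), if_true, if_false]

/-- For a nested pair every defect factor `1 − β_S ∈ {0, w, 1}` is Bernstein-positive of degree `1`. [this work] -/
theorem bpos_one_sub_mix {𝒰 𝒱 : Finset (Finset (Fin n))} (hUV : 𝒰 ⊆ 𝒱) (S : Finset (Fin n)) :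
    BPos 1 (fun w => 1 - mix 𝒰 𝒱 w S) := by
  unfold mix
  by_cases hU : S ∈ 𝒰
  · have hV : S ∈ 𝒱 := hUV hU
    exact (bpos_zero.mono (Nat.zero_le 1)).congr fun w => by rw [if_pos hU, if_pos hV]; ring
  · by_cases hV : S ∈ 𝒱
    · exact bpos_id.congr fun w => by rw [if_neg hU, if_pos hV]; ring
    · exact (bpos_const zero_le_one).congr fun w => by rw [if_neg hU, if_neg hV]; ring

/-- A permutation of `Fin k` has at most `k` cycles. [folklore] -/
theorem card_orbits_le {k : ℕ} (σ : Perm (Fin k)) : (orbits σ).card ≤ k := by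
  unfold orbits
  exact card_image_le.trans (by rw [card_univ, Fintype.card_fin])

/-- `W(β) = Σ_σ ∏_{c ∈ cyc σ} (1 − β_c)` is Bernstein-positive of degree `k` along a nested mixture on `Fin (k+1)`. [this work] -/
theorem bpos_W {k : ℕ} {𝒰 𝒱 : Finset (Finset (Fin (k + 1)))} (hUV : 𝒰 ⊆ 𝒱) :
    BPos k (fun w => ∑ σ : Perm (Fin k), ∏ B ∈ orbits σ, (1 - mix 𝒰 𝒱 w (B.map Fin.castSuccEmb))) := by
  refine BPos.sum univ (fun σ w => ∏ B ∈ orbits σ, (1 - mix 𝒰 𝒱 w (B.map Fin.castSuccEmb))) fun σ _ => ?_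
  exact (BPos.prod (orbits σ) (fun B w => 1 - mix 𝒰 𝒱 w (B.map Fin.castSuccEmb))
    fun B _ => bpos_one_sub_mix hUV _).mono (card_orbits_le σ)

/-- Relabelling a pair by a permutation of the ground set: pulled-back families, same edge polynomial. [this work] -/
theorem phiSet_mix_comap_perm (σ : Perm (Fin (n + 1))) (𝒰 𝒱 : Finset (Finset (Fin (n + 1)))) (w : ℝ) :
    phiSet (n + 1) (mix (comap σ.toEmbedding 𝒰) (comap σ.toEmbedding 𝒱) w) = phiSet (n + 1) (mix 𝒰 𝒱 w) := by
  rw [← mix_map σ.toEmbedding 𝒰 𝒱 w]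
  exact PhiCert.phiSet_actV σ (mix 𝒰 𝒱 w)

end BernsteinPos

end Summit.CriticalPhenomena.PercolationContinuityZ3.Theorems
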